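import Summits.ValiantsHypothesis.ValiantsHypothesis.Theorems.ToricFixedPoints.Negative.FormDeborderingG3NotEnd
import Summits.ValiantsHypothesis.ValiantsHypothesis.Theorems.ToricFixedPoints.Negative.FormDeborderingEndType
import Literature.Computability.AlgebraicComplexity.PaddedPowerSums

/-!
# `ToricFixedPoints` / line `form_then_lift`, stub F1: padded block forms are End-type iff `dc ≤ m`

For a form `q` of degree `s ≤ m` in the nine variables of a `3 × 3` matrix and `m ≥ 4`, write
`q(Y)` for `q` evaluated on the lower-right `3 × 3` block of the `m × m` variable matrix and
`ℓ = X (0,0)`.  Then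

* `paddedBlock3_mem_endOrbit_iff_dc_le`:
  `ℓ^{m-s} · q(Y) ∈ End(ℂ^{m²})·det_m  ↔  dc(q) ≤ m`
  (`←`: Bürgisser–Ikenmeyer–Panova homogenisation, tree `X_pow_mul_aeval_mem_endOrbit_detPoly`;
  `→`: specialise `ℓ ↦ 1`, tree `hasDetRepr_aeval_of_linSubst_detPoly_eq`);
* `paddedBlock3_formDebordering_of_dc_le`: hence for `dc(q) ≤ m` the padded form has F1's toric shape
  OUTRIGHT (`formDebordering_of_mem_endOrbit`), no border hypothesis needed.

Use for the form-level positive cases of F1 at `(3,m)`: by `FormDeborderingTestSpace` every test form is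
`ℓ^a · G(Y)` with `G` content-homogeneous of degree `m - a`; whenever `dc(G) ≤ m` (all five degenerate
cubic content classes, `dc ≤ 3`; every quadratic or linear `G`; `det₃`-type cubics) F1 holds for it, and
F1's content is confined to padded forms with `dc(G) > m` that are nevertheless border points — at `(3,5)`,
`(3,6)` e.g. `G₃` (`dc = 7`) IF `ℓ^{m-3}G₃` is a limit.  Refuter/theory seat `val-width-5779-d1`
(stmt-ValiantsHypothesis-5779).  VP ≠ VNP is not touched.
-/

open MvPolynomial Finset
open Literature.Computability.AlgebraicComplexity

namespace Summit.ValiantsHypothesis.Cruxes.ToricFixedPoints.Negative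

/-- **Padded block forms: End-type iff `dc ≤ m`.**  `m ≥ 4`, `q` a form of degree `s ≤ m` in the
`3 × 3` variables; `ℓ^{m-s}·q(Y) ∈ End·det_m ↔ dc(q) ≤ m`. [folklore] -/
theorem paddedBlock3_mem_endOrbit_iff_dc_le (m : ℕ) [NeZero m] (hm : 4 ≤ m) {s : ℕ} (hs : s ≤ m)
    (q : MvPolynomial (Fin 3 × Fin 3) ℂ) (hq : q.IsHomogeneous s) :
    let y : Fin 3 × Fin 3 → MvPolynomial (Fin m × Fin m) ℂ :=
      fun ab => X (⟨m - 3 + ab.1, by omega⟩, ⟨m - 3 + ab.2, by omega⟩)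
    X ((0 : Fin m), (0 : Fin m)) ^ (m - s) * aeval y q ∈
        endOrbit (Fin m × Fin m) ℂ (detPoly (Fin m) ℂ) ↔
      determinantalComplexity q ≤ m := by
  intro y
  constructor
  · rintro ⟨A, hA⟩
    dsimp only at hA
    -- specialisation: block variables to the `3 × 3` variables, everything else to `1`
    let g : Fin m × Fin m → MvPolynomial (Fin 3 × Fin 3) ℂ := fun p =>
      if h : m - 3 ≤ (p.1 : ℕ) ∧ m - 3 ≤ (p.2 : ℕ) then
        X (⟨(p.1 : ℕ) - (m - 3), by omega⟩, ⟨(p.2 : ℕ) - (m - 3), by omega⟩)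
      else 1
    have hg : ∀ p, (g p).totalDegree ≤ 1 := by
      intro p
      simp only [g]
      split_ifs
      · exact (totalDegree_X _).le
      · simp
    have hgy : ∀ ab : Fin 3 × Fin 3, aeval g (y ab) = (X ab : MvPolynomial (Fin 3 × Fin 3) ℂ) := by
      intro ab
      simp only [y, aeval_X, g]
      rw [dif_pos ⟨by simp, by simp⟩]
      congr 1; ext <;> simp
    have hℓ : aeval g ((X ((0 : Fin m), (0 : Fin m)) : MvPolynomial (Fin m × Fin m) ℂ) ^ (m - s)) =
        1 := by
      rw [map_pow, aeval_X]
      have : g ((0 : Fin m), (0 : Fin m)) = 1 := by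
        simp only [g]
        rw [dif_neg]
        simp only [Fin.val_zero, nonpos_iff_eq_zero, not_and]
        omega
      rw [this, one_pow]
    have hrepr := hasDetRepr_aeval_of_linSubst_detPoly_eq m A _ hA g hg
    rw [map_mul, hℓ, one_mul, ← AlgHom.comp_apply, comp_aeval] at hrepr
    have hid : (fun i => aeval g (y i)) = fun i => (X i : MvPolynomial (Fin 3 × Fin 3) ℂ) :=
      funext hgy
    rw [hid, aeval_X_left, AlgHom.id_apply] at hrepr
    exact determinantalComplexity_le_of_hasDetRepr hrepr
  · intro h
    have hA : HasDetRepr q m := (hasDetRepr_iff_determinantalComplexity_le_holds q m).2 h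
    exact X_pow_mul_aeval_mem_endOrbit_detPoly hq hs hA (isHomogeneous_X ℂ _) (X_ne_zero _) y
      (fun t => isHomogeneous_X ℂ _)

/-- **Positive cases of F1 from affine determinantal complexity.**  `m ≥ 4`, `q` a form of degree
`s ≤ m` in the `3 × 3` variables with `dc(q) ≤ m`: the padded form `ℓ^{m-s}·q(Y)` has the toric shape
demanded by `stub_formDebordering` outright (with `a = 1`-type scalar, `e = m`), regardless of any border
hypothesis. [folklore] -/
theorem paddedBlock3_formDebordering_of_dc_le (m : ℕ) [NeZero m] (hm : 4 ≤ m) {s : ℕ} (hs : s ≤ m)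
    (q : MvPolynomial (Fin 3 × Fin 3) ℂ) (hq : q.IsHomogeneous s)
    (hdc : determinantalComplexity q ≤ m) :
    let y : Fin 3 × Fin 3 → MvPolynomial (Fin m × Fin m) ℂ :=
      fun ab => X (⟨m - 3 + ab.1, by omega⟩, ⟨m - 3 + ab.2, by omega⟩)
    ∃ (u g : Matrix.GeneralLinearGroup (Fin m × Fin m) ℂ) (w : Fin m × Fin m → ℕ) (e : ℕ) (a : ℂ),
      a ≠ 0 ∧
      (∀ d ∈ (linSubst (Fin m × Fin m) ℂ (g : Matrix (Fin m × Fin m) (Fin m × Fin m) ℂ)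
          (detPoly (Fin m) ℂ)).support, Finsupp.weight w d ≤ e) ∧
      X ((0 : Fin m), (0 : Fin m)) ^ (m - s) * aeval y q =
        a • linSubst (Fin m × Fin m) ℂ (u : Matrix (Fin m × Fin m) (Fin m × Fin m) ℂ)
          (MvPolynomial.weightedHomogeneousComponent w e
            (linSubst (Fin m × Fin m) ℂ (g : Matrix (Fin m × Fin m) (Fin m × Fin m) ℂ)
              (detPoly (Fin m) ℂ))) :=
  formDebordering_of_mem_endOrbit m ((paddedBlock3_mem_endOrbit_iff_dc_le m hm hs q hq).2 hdc)

end Summit.ValiantsHypothesis.Cruxes.ToricFixedPoints.Negative
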